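import Mathlib
import Summits.QuantumFields.BalabanUV.Beta.FP.PerfectFFBlockRowSumTorus

/-!
# `BalabanUV.Beta.FP.PerfectFFBlockRowDiffTorus` — road «FP» (binder row D1), lane IR-5′, **THE (T1′) SOCKET, FILE F5a (TORUS SIDE):
# ROW DIFFERENCES OF THE PERIODISED ff BLOCK** — for one coarse unit step `e_μ` in the ROW variable,
# `Σ_{y′∈Q} |Σ_t (unitK Mb sm (KTot N Mb))(x′+e_μ, y′+(nM)•t) ff − Σ_t (…)(x′, y′+(nM)•t) ff| ≤ ½·N²·Mb^{2−d}·C₁` on every torus `(N, M)`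
# whose hard covariance `𝒞` carries the GRADIENT row-sum letter `C₁` (`Σ_j ‖𝒞(i+ê_μ) j − 𝒞 i j‖ ≤ C₁`, the fine unit step `ê_μ`) and which is
# large against `Q` — our bookkeeping over g17's junction `tsum_unitK_KTot_ff_pshift_eq`, F4a's fibre count `card_legFibre_le`, an2's block-contour legs
# (`legPt_add`: the row legs of `x′+e_μ` are the row legs of `x′` moved by `Mb` FINE steps) and an `Mb`-step telescoping; no estimate of Bałaban's objects is
# proved here — the letter `C₁` is a HYPOTHESIS displayed in the signature

HONEST DEPENDENCY (page 1, mandatory): continuum YM on T⁴ ⇐ BetaPertH ∧ nine spine estimates (0/9 proved); BetaPertH ⇐ (D1) ∧ (D4) ∧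
CAP+tail; G-an2-4 gates asym, D1 and NE2/3/4.  HONEST FRAMING (cell contract, verbatim): «discharging `BetaPertH` makes Bałaban's UV
stability UNCONDITIONAL — a real constructive-QFT result; it is NOT the continuum limit and NOT the Clay problem.»  THIS MODULE is finite bookkeeping
BY NAME (F4a `PerfectFFBlockRowSumTorus` = the same computation for the row SUMS); it cites nothing, mints no `Prop`, has no `def`, 0 sorry.
WHAT IT IS NOT: NOT the letter `C₁` — that is (1.115)'s SECOND entry «|∇GJ| ≤ O(1)|J|» (B5 = Bałaban, CMP 95 (1984) p. 36) for the HARD covariance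
`𝒞 = G − ∂Δ⁻¹RΔ⁻¹∂ᴴ − GQ*(QGQ*)⁻¹QG` (`CovarianceGaugeFactor.Cov_eq_free_gauge'`) in row-sum currency with the gain `C₁ ≍ N⁻¹`, whose suppliers
((1.115)'s second entry for the VECTOR `G = Δ_1⁻¹` — in the tree on CUBIC tori, t4-ne3-p1's `SliceFlatGradient` transported by t4-ne2-formalise-leaf-05's
`GradientRowSumTransport`, assembled in F5e `CovarianceRowDiffTower` — and a log-free gradient row-sum bound for the COMPOSITE gauge factor `∂Δ⁻¹RΔ⁻¹∂ᴴ`, NOT in the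
tree) are NOT attempted here; NOT (T1′) (F5b de-periodises and passes to `j → ∞`), NOT hslice, NOT (ASYMP), NOT D1, NOT BetaPertH, NOT continuum, NOT Clay.

ABSOLUTE RULE (cell charter, verbatim): «No internally-minted statement may enter as a cited fact. Every hypothesis is either kernel-proved in this
package or a verbatim quotation of a PUBLISHED theorem with page reference. The manuscript(s) under audit are NOT citable for their own disputed
steps — they are the thing under adjudication; programme-internal (2001/route/tribunal) claims are never citable.»

WHY ½·N²·Mb^{2−d}·C₁ (compare F4a's ½·N²·Mb^{1−d}·C): the row `x′` of the periodised block is `(Mb²N²∕2)·Σ_i legW_i Σ_{i′,y′} legW_{i′}·Re 𝒞(p_i, q_{i′}(y′))`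
(g17); the row `x′ + e_μ` has the SAME column legs and the row legs `p_i + Mb·ê_μ` (`legPt_add`, `toTor_zsmul`, `toTor_unitVec`); telescoping the `Mb` fine steps,
each step costs `legW·Mb·C₁` over a separated `Q` (fibres `≤ Mb`, `card_legFibre_le`), so the row difference is at most `(Mb²N²∕2)·Mb^{−(d+2)}·Mb·Mb·C₁ = ½N²Mb^{2−d}·C₁`;
at `d = 3`, `N = n·Mb`, `C₁ = c₁∕N`: `½·n·c₁` — the power count (T1′) `≍ n` wants, uniformly in `j`.

CONTENT.  §1 [folklore] `norm_sub_le_sum_range_norm_sub` (telescoping), **`sum_legW_le_of_rowSum`** (F4a §3 for an arbitrary nonnegative row function);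
§2 `toTor_legPt_add_unitVec` (the row legs move by `Mb` fine unit steps); §3 **`sum_legW_norm_Cov_rowDiff_le`** (one row leg: the `Mb`-step difference against the
column legs over a separated `Q` costs `legW·Mb·Mb·C₁`); §4 **`sum_abs_tsum_unitK_KTot_ff_pshift_rowDiff_le`** (the headline).
Unit `b2b-balaban-beta-d1-formalise-leaf-05` (gen 22), 2026-08-21; `LEAVES-FP.md` row «(T1′) SOCKET F5a».  «not in print; our bookkeeping».
-/

noncomputable section

open scoped BigOperators Matrix ComplexConjugate
open Filter Topology

namespace Summit.QuantumFields.BalabanUV.Beta.FP.PerfectFFBlockRowDiffTorus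

open Matrix
open Literature.MathematicalPhysics.QuantumFieldTheory.Balaban1983to89
open Literature.MathematicalPhysics.QuantumFieldTheory.Balaban1983to89.Beta
open AffineAveraging (Site)
open B5Prop11Plancherel (Tor fine)
open FluctuationProjection (Cov)
open OneStepResolventKernel (Fib)
open OneStepKernelFamily (LegIdx legPt legW legSet sum_legW legW_nonneg legPt_add)
open Summit.QuantumFields.BalabanUV.Beta.HessKerDressedUnits (unitK)
open Summit.QuantumFields.BalabanUV.Beta.GAN24.TorusAvatar (toTor toTor_add toTor_zsmul toTor_unitVec)
open Summit.QuantumFields.BalabanUV.Beta.GAN24.TorusPeriodise (pshift)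
open Summit.QuantumFields.BalabanUV.Beta.FP.PerfectObjects (KTot)
open Summit.QuantumFields.BalabanUV.Beta.FP.PerfectFFBlockBounded (tsum_unitK_KTot_ff_pshift_eq)
open Summit.QuantumFields.BalabanUV.Beta.FP.PerfectFFBlockRowSumTorus (sum_comp_le_of_fibre card_legFibre_le)

/-! ## §1 Telescoping and the fibre sum against an arbitrary row function -/

section Generic

/-- [folklore] **TELESCOPING**: `‖f m − f 0‖ ≤ Σ_{s<m} ‖f (s+1) − f s‖`. -/
theorem norm_sub_le_sum_range_norm_sub (f : ℕ → ℂ) (m : ℕ) : ‖f m - f 0‖ ≤ ∑ s ∈ Finset.range m, ‖f (s + 1) - f s‖ := by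
  rw [← Finset.sum_range_sub f m]
  exact norm_sum_le _ _

variable {d : ℕ} (N : ℕ) [NeZero N] (M : Fin (d + 1) → ℕ) [hM : ∀ ν, NeZero (M ν)] (Mb : ℕ)

/-- [folklore] **THE INNER LEG∕BLOCK SUM AGAINST ONE NONNEGATIVE ROW FUNCTION** (F4a's `sum_legW_norm_Cov_le` for any `g ≥ 0` with `Σ_j g j ≤ C`): over a set
of blocks `Q` separated against the fine periods, `Σ_{y′∈Q} Σ_{i′∈LegIdx} legW·g (q_{i′}(y′), l) ≤ legW·Mb·C` (fibres `≤ Mb`, `card_legFibre_le`; the `l`-slice is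
at most the whole sum). -/
theorem sum_legW_le_of_rowSum {g : Tor (fine N M) × Fin (d + 1) → ℝ} (hg : ∀ j, 0 ≤ g j) {C : ℝ} (hC : ∑ j, g j ≤ C) (l : Fin (d + 1))
    (Q : Finset (Site (d + 1))) (hQ : ∀ y₁ ∈ Q, ∀ y₂ ∈ Q, ∀ ν, (Mb : ℤ) * |y₁ ν - y₂ ν| + Mb ≤ fine N M ν) :
    ∑ y' ∈ Q, ∑ i' ∈ LegIdx d Mb, legW d Mb (Sum.inl l : Fib d) * g (toTor (fine N M) (legPt (d := d) Mb (Sum.inl l) y' i'), l)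
      ≤ legW d Mb (Sum.inl l : Fib d) * (Mb * C) := by
  classical
  rw [← Finset.sum_product (s := Q) (t := LegIdx d Mb)
    (f := fun yi => legW d Mb (Sum.inl l : Fib d) * g (toTor (fine N M) (legPt (d := d) Mb (Sum.inl l) yi.1 yi.2), l)),
    ← Finset.mul_sum]
  refine mul_le_mul_of_nonneg_left ?_ (legW_nonneg (d := d) Mb _)
  have hfib := sum_comp_le_of_fibre (Q ×ˢ LegIdx d Mb) (fun yi => toTor (fine N M) (legPt (d := d) Mb (Sum.inl l) yi.1 yi.2))
    (fun z => g (z, l)) (fun _ => hg _) (card_legFibre_le Mb l Q hQ)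
  refine hfib.trans (mul_le_mul_of_nonneg_left ?_ (Nat.cast_nonneg Mb))
  calc ∑ z : Tor (fine N M), g (z, l)
      ≤ ∑ z : Tor (fine N M), ∑ l' : Fin (d + 1), g (z, l') :=
        Finset.sum_le_sum fun z _ => Finset.single_le_sum (f := fun l' => g (z, l')) (fun _ _ => hg _) (Finset.mem_univ l)
    _ = ∑ j, g j := by rw [← Fintype.sum_prod_type']
    _ ≤ C := hC

end Generic

/-! ## §2 The row legs of `x′ + e_μ` are the row legs of `x′` moved by `Mb` fine unit steps -/

section Legs

variable {d : ℕ} (P : Fin (d + 1) → ℕ) (Mb : ℕ)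

/-- [folklore] `toTor P (legPt Mb a (x′ + e_μ) i) = toTor P (legPt Mb a x′ i) + Mb • ê_μ` (an2's `legPt_add` read on the torus; `ê_μ` = b05's
`B5Prop11Plancherel.unitVec`). -/
theorem toTor_legPt_add_unitVec (a : Fib d) (x' : Site (d + 1)) (μ : Fin (d + 1)) (i : (Fin (d + 1) → ℕ) × ℕ) :
    toTor P (legPt (d := d) Mb a (x' + AffineAveraging.unitVec μ) i)
      = toTor P (legPt (d := d) Mb a x' i) + Mb • B5Prop11Plancherel.unitVec P μ := by
  rw [legPt_add, toTor_add, toTor_zsmul, toTor_unitVec, natCast_zsmul]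

end Legs

/-! ## §3 One row leg: the `Mb`-step difference against the column legs -/

section RowLeg

variable {d : ℕ} (N : ℕ) [NeZero N] (hN : 1 ≤ N) (M : Fin (d + 1) → ℕ) [hM : ∀ ν, NeZero (M ν)] (Mb : ℕ)

include hN in
/-- [our bookkeeping] **ONE ROW LEG MOVED BY `Mb` FINE STEPS, AGAINST THE COLUMN LEGS**: with the gradient row-sum letter
`Σ_j ‖𝒞(z+ê_μ, κ) j − 𝒞(z, κ) j‖ ≤ C₁` (all `z κ μ`), for every fine row point `p`, components `κ l`, direction `μ` and a separated `Q`,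
`Σ_{y′∈Q} Σ_{i′} legW·‖𝒞(p + Mb•ê_μ, κ)(q_{i′}(y′), l) − 𝒞(p, κ)(q_{i′}(y′), l)‖ ≤ legW·Mb·Mb·C₁` (telescoping + §1 once per step). -/
theorem sum_legW_norm_Cov_rowDiff_le {C₁ : ℝ}
    (hC1 : ∀ (i : Tor (fine N M) × Fin (d + 1)) (μ : Fin (d + 1)),
      ∑ j, ‖Cov N hN M 1 one_pos (i.1 + B5Prop11Plancherel.unitVec (fine N M) μ, i.2) j - Cov N hN M 1 one_pos i j‖ ≤ C₁)
    (p : Tor (fine N M)) (κ l μ : Fin (d + 1)) (Q : Finset (Site (d + 1)))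
    (hQ : ∀ y₁ ∈ Q, ∀ y₂ ∈ Q, ∀ ν, (Mb : ℤ) * |y₁ ν - y₂ ν| + Mb ≤ fine N M ν) :
    ∑ y' ∈ Q, ∑ i' ∈ LegIdx d Mb, legW d Mb (Sum.inl l : Fib d) *
        ‖Cov N hN M 1 one_pos (p + Mb • B5Prop11Plancherel.unitVec (fine N M) μ, κ) (toTor (fine N M) (legPt (d := d) Mb (Sum.inl l) y' i'), l)
          - Cov N hN M 1 one_pos (p, κ) (toTor (fine N M) (legPt (d := d) Mb (Sum.inl l) y' i'), l)‖
      ≤ legW d Mb (Sum.inl l : Fib d) * (Mb * (Mb * C₁)) := by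
  set e := B5Prop11Plancherel.unitVec (fine N M) μ with he
  -- telescoping in each term
  have htel : ∀ q : Tor (fine N M) × Fin (d + 1),
      ‖Cov N hN M 1 one_pos (p + Mb • e, κ) q - Cov N hN M 1 one_pos (p, κ) q‖
        ≤ ∑ s ∈ Finset.range Mb, ‖Cov N hN M 1 one_pos (p + (s + 1) • e, κ) q - Cov N hN M 1 one_pos (p + s • e, κ) q‖ := by
    intro q
    have h := norm_sub_le_sum_range_norm_sub (fun s => Cov N hN M 1 one_pos (p + s • e, κ) q) Mb
    simpa only [zero_nsmul, add_zero] using h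
  have hwl : 0 ≤ legW d Mb (Sum.inl l : Fib d) := legW_nonneg (d := d) Mb _
  calc ∑ y' ∈ Q, ∑ i' ∈ LegIdx d Mb, legW d Mb (Sum.inl l : Fib d) *
          ‖Cov N hN M 1 one_pos (p + Mb • e, κ) (toTor (fine N M) (legPt (d := d) Mb (Sum.inl l) y' i'), l)
            - Cov N hN M 1 one_pos (p, κ) (toTor (fine N M) (legPt (d := d) Mb (Sum.inl l) y' i'), l)‖
      ≤ ∑ y' ∈ Q, ∑ i' ∈ LegIdx d Mb, legW d Mb (Sum.inl l : Fib d) *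
          ∑ s ∈ Finset.range Mb, ‖Cov N hN M 1 one_pos (p + (s + 1) • e, κ) (toTor (fine N M) (legPt (d := d) Mb (Sum.inl l) y' i'), l)
            - Cov N hN M 1 one_pos (p + s • e, κ) (toTor (fine N M) (legPt (d := d) Mb (Sum.inl l) y' i'), l)‖ :=
        Finset.sum_le_sum fun y' _ => Finset.sum_le_sum fun i' _ => mul_le_mul_of_nonneg_left (htel _) hwl
    _ = ∑ s ∈ Finset.range Mb, ∑ y' ∈ Q, ∑ i' ∈ LegIdx d Mb, legW d Mb (Sum.inl l : Fib d) *
          ‖Cov N hN M 1 one_pos (p + (s + 1) • e, κ) (toTor (fine N M) (legPt (d := d) Mb (Sum.inl l) y' i'), l)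
            - Cov N hN M 1 one_pos (p + s • e, κ) (toTor (fine N M) (legPt (d := d) Mb (Sum.inl l) y' i'), l)‖ := by
        conv_rhs => rw [Finset.sum_comm]
        refine Finset.sum_congr rfl fun y' _ => ?_
        simp_rw [Finset.mul_sum]
        exact Finset.sum_comm
    _ ≤ ∑ _s ∈ Finset.range Mb, legW d Mb (Sum.inl l : Fib d) * (Mb * C₁) := by
        refine Finset.sum_le_sum fun s _ => ?_
        have hrow : ∑ j, ‖Cov N hN M 1 one_pos (p + (s + 1) • e, κ) j - Cov N hN M 1 one_pos (p + s • e, κ) j‖ ≤ C₁ := by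
          have h := hC1 (p + s • e, κ) μ
          simpa only [he, succ_nsmul, add_assoc] using h
        exact sum_legW_le_of_rowSum N M Mb (g := fun j => ‖Cov N hN M 1 one_pos (p + (s + 1) • e, κ) j - Cov N hN M 1 one_pos (p + s • e, κ) j‖)
          (fun _ => norm_nonneg _) hrow l Q hQ
    _ = legW d Mb (Sum.inl l : Fib d) * (Mb * (Mb * C₁)) := by
        rw [Finset.sum_const, Finset.card_range, nsmul_eq_mul]
        ring

end RowLeg

/-! ## §4 Row differences of the periodised ff block -/

section RowDiff

variable {d : ℕ} (N : ℕ) [NeZero N] (hN : 1 ≤ N) (M : Fin (d + 1) → ℕ) [hM : ∀ ν, NeZero (M ν)] (Mb n : ℕ)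

include hN in
/-- [our bookkeeping] **ROW DIFFERENCES OF THE PERIODISED ff BLOCK**: for `N = n·Mb`, `Mb ≥ 1`, a torus `(N, M)` whose hard covariance carries the
GRADIENT row-sum letter `Σ_j ‖𝒞(i+ê_μ) j − 𝒞 i j‖ ≤ C₁`, a coarse direction `μ` and a set of blocks `Q` separated against the coarse periods:
`Σ_{y′∈Q} |Σ_t (unitK Mb sm (KTot N Mb))(x′+e_μ, y′+(nM)•t) ff − Σ_t (unitK Mb sm (KTot N Mb))(x′, y′+(nM)•t) ff| ≤ (Mb²N²∕2)·legW·Mb·Mb·C₁`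
(`legW = Mb^{−(d+2)}`; at `d = 3`: `½·(N∕Mb)²·Mb·C₁`). -/
theorem sum_abs_tsum_unitK_KTot_ff_pshift_rowDiff_le (hMb : 1 ≤ Mb) (hMbN : N = n * Mb) {C₁ : ℝ}
    (hC1 : ∀ (i : Tor (fine N M) × Fin (d + 1)) (μ : Fin (d + 1)),
      ∑ j, ‖Cov N hN M 1 one_pos (i.1 + B5Prop11Plancherel.unitVec (fine N M) μ, i.2) j - Cov N hN M 1 one_pos i j‖ ≤ C₁)
    (sm : ℝ) (x' : Site (d + 1)) (μ κ l : Fin (d + 1)) (Q : Finset (Site (d + 1)))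
    (hQ : ∀ y₁ ∈ Q, ∀ y₂ ∈ Q, ∀ ν, (Mb : ℤ) * |y₁ ν - y₂ ν| + Mb ≤ fine N M ν) :
    ∑ y' ∈ Q, |(∑' t : Site (d + 1), unitK (Mb : ℝ) sm (KTot (d := d) N Mb) (x' + AffineAveraging.unitVec μ) (y' + pshift (fine n M) t) (Sum.inl κ) (Sum.inl l))
        - ∑' t : Site (d + 1), unitK (Mb : ℝ) sm (KTot (d := d) N Mb) x' (y' + pshift (fine n M) t) (Sum.inl κ) (Sum.inl l)|
      ≤ ((Mb : ℝ) ^ 2 * (N : ℝ) ^ 2 / 2) * (legW d Mb (Sum.inl l : Fib d) * (Mb * (Mb * C₁))) := by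
  have hMb0 : Mb ≠ 0 := by omega
  have hpos : 0 ≤ (Mb : ℝ) ^ 2 * (N : ℝ) ^ 2 / 2 := by positivity
  have hwκ : 0 ≤ legW d Mb (Sum.inl κ : Fib d) := legW_nonneg (d := d) Mb _
  have hwl : 0 ≤ legW d Mb (Sum.inl l : Fib d) := legW_nonneg (d := d) Mb _
  set e := B5Prop11Plancherel.unitVec (fine N M) μ with he
  -- each term through the junction (twice), the shifted row legs, then the triangle inequality
  have hterm : ∀ y' ∈ Q,
      |(∑' t : Site (d + 1), unitK (Mb : ℝ) sm (KTot (d := d) N Mb) (x' + AffineAveraging.unitVec μ) (y' + pshift (fine n M) t) (Sum.inl κ) (Sum.inl l))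
          - ∑' t : Site (d + 1), unitK (Mb : ℝ) sm (KTot (d := d) N Mb) x' (y' + pshift (fine n M) t) (Sum.inl κ) (Sum.inl l)|
        ≤ ((Mb : ℝ) ^ 2 * (N : ℝ) ^ 2 / 2) * ∑ i ∈ LegIdx d Mb, legW d Mb (Sum.inl κ : Fib d) *
            ∑ i' ∈ LegIdx d Mb, legW d Mb (Sum.inl l : Fib d) *
              ‖Cov N hN M 1 one_pos (toTor (fine N M) (legPt (d := d) Mb (Sum.inl κ) x' i) + Mb • e, κ)
                  (toTor (fine N M) (legPt (d := d) Mb (Sum.inl l) y' i'), l)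
                - Cov N hN M 1 one_pos (toTor (fine N M) (legPt (d := d) Mb (Sum.inl κ) x' i), κ)
                  (toTor (fine N M) (legPt (d := d) Mb (Sum.inl l) y' i'), l)‖ := by
    intro y' _
    rw [tsum_unitK_KTot_ff_pshift_eq N hN M Mb n hMbN sm (x' + AffineAveraging.unitVec μ) y' κ l,
      tsum_unitK_KTot_ff_pshift_eq N hN M Mb n hMbN sm x' y' κ l, ← mul_sub, ← Finset.sum_sub_distrib, abs_mul, abs_of_nonneg hpos]
    refine mul_le_mul_of_nonneg_left ?_ hpos
    refine (Finset.abs_sum_le_sum_abs _ _).trans (Finset.sum_le_sum fun i _ => ?_)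
    rw [← Finset.sum_sub_distrib, Finset.mul_sum]
    refine (Finset.abs_sum_le_sum_abs _ _).trans (Finset.sum_le_sum fun i' _ => ?_)
    rw [← mul_sub, abs_mul, abs_mul, abs_of_nonneg hwκ, abs_of_nonneg hwl, mul_assoc, toTor_legPt_add_unitVec, ← he, ← Complex.sub_re]
    exact mul_le_mul_of_nonneg_left (mul_le_mul_of_nonneg_left (Complex.abs_re_le_norm _) hwl) hwκ
  refine (Finset.sum_le_sum hterm).trans ?_
  rw [← Finset.mul_sum]
  refine mul_le_mul_of_nonneg_left ?_ hpos
  -- swap the `y′` and `i` sums and use §3 for each row leg point `p_i`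
  rw [Finset.sum_comm]
  calc ∑ i ∈ LegIdx d Mb, ∑ y' ∈ Q, legW d Mb (Sum.inl κ : Fib d) *
          ∑ i' ∈ LegIdx d Mb, legW d Mb (Sum.inl l : Fib d) *
            ‖Cov N hN M 1 one_pos (toTor (fine N M) (legPt (d := d) Mb (Sum.inl κ) x' i) + Mb • e, κ)
                (toTor (fine N M) (legPt (d := d) Mb (Sum.inl l) y' i'), l)
              - Cov N hN M 1 one_pos (toTor (fine N M) (legPt (d := d) Mb (Sum.inl κ) x' i), κ)
                (toTor (fine N M) (legPt (d := d) Mb (Sum.inl l) y' i'), l)‖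
      = ∑ i ∈ LegIdx d Mb, legW d Mb (Sum.inl κ : Fib d) *
          ∑ y' ∈ Q, ∑ i' ∈ LegIdx d Mb, legW d Mb (Sum.inl l : Fib d) *
            ‖Cov N hN M 1 one_pos (toTor (fine N M) (legPt (d := d) Mb (Sum.inl κ) x' i) + Mb • e, κ)
                (toTor (fine N M) (legPt (d := d) Mb (Sum.inl l) y' i'), l)
              - Cov N hN M 1 one_pos (toTor (fine N M) (legPt (d := d) Mb (Sum.inl κ) x' i), κ)
                (toTor (fine N M) (legPt (d := d) Mb (Sum.inl l) y' i'), l)‖ := by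
        refine Finset.sum_congr rfl fun i _ => ?_
        rw [Finset.mul_sum]
    _ ≤ ∑ i ∈ LegIdx d Mb, legW d Mb (Sum.inl κ : Fib d) * (legW d Mb (Sum.inl l : Fib d) * (Mb * (Mb * C₁))) :=
        Finset.sum_le_sum fun i _ => mul_le_mul_of_nonneg_left (sum_legW_norm_Cov_rowDiff_le N hN M Mb hC1 _ κ l μ Q hQ) hwκ
    _ = legW d Mb (Sum.inl l : Fib d) * (Mb * (Mb * C₁)) := by
        rw [← Finset.sum_mul]
        have h1 : ∑ _i ∈ LegIdx d Mb, legW d Mb (Sum.inl κ : Fib d) = 1 := sum_legW (d := d) hMb0 (Sum.inl κ)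
        rw [h1, one_mul]

end RowDiff

end Summit.QuantumFields.BalabanUV.Beta.FP.PerfectFFBlockRowDiffTorus

end
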